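import Summits.BirchSwinnertonDyer.BirchSwinnertonDyer.Theorems.ManinLocalTwoThreeCuspHeckeShiftRelations
import HarnessLib

/-!
# Hecke and shift operators on the boundary symbols of `Γ₀(M)`

Summit `BirchSwinnertonDyer`, route `ManinLocalTwoThree` (cell bsd-f2-manin), cruxes C2 `ManinOddAtFour`
(stmt-BirchSwinnertonDyer-22967) / C3 `ManinPrimeToThreeAtNine` (stmt-BirchSwinnertonDyer-22968).  Sixth file of the
cusp-symbol layer (MEMO-es §22–§23) toward E-es-30 `BoundaryEisenstein`.  The BOUNDARY SYMBOLS of level `M` are the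
image `B_M = boundaryOf K (cuspInvariants M K)` of the `Γ₀(M)`-invariant functions `w` on `P¹(ℚ)` under
`D w (a,b) = w(b) − w(a)` (`Theorems/ManinLocalTwoThreeDefs.lean`).  On `B_M`, for primes `q, r ∤ M`, with
`A_r = symbolShift K (heckeNbrInfty hr)` (`ρ_r`) and `B_r = symbolShift K (heckeNbrZero hr)` (`ρ_r⁻¹`):

* `T_r = A_r + r B_r` (`symbolHecke_eq_shift_of_mem`, from `cuspFunHecke_eq_heckeNbr`);
* `A_r, B_r, T_r` preserve `B_M`; `B_r A_r = A_r B_r = 1`, `A_q A_r = A_r A_q`, `A_q B_r = B_r A_q`, `A_q T_r = T_r A_q`;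
* `A_{r₁} A_{r₂} = A_u` for `r₁ r₂ ≡ u`, `A_u = 1` for `u ≡ 1`, `A_r = A_{r'}` for `r ≡ r'` (mod `M`);
* `A_q` preserves `B_M ∩ (generalised λ-eigenspace of T_r)` (`symbolShift_mem_maxGenEigenspace`);
* `cuspInvariants M K` is finite-dimensional (`finiteDimensional_cuspInvariants`: a `Γ₀(M)`-invariant function factors
  through the bottom row mod `M` of `cuspMatrix`, a map to the finite set `(ℤ/M)²`).

These are exactly the inputs of the eigen-analysis «a simultaneous `A`-eigenvector in the `λ`-part forces
`λ_r = χ(r) + r χ(r)⁻¹`» of the next file.  No new definitions; nothing about BSD or Manin's conjecture is proved here.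

References: G. Shimura (1971) §8.3; F. Diamond, J. Shurman, GTM 228, §5.2 and Prop. 3.8.3; G. Stevens, *Arithmetic on
modular curves* (1982) Ch. 1–2 (boundary symbols, Eisenstein); cell memo HOME/MEMO-es.md §22.3.
-/

set_option autoImplicit false
set_option linter.dupNamespace false

open scoped MatrixGroups

open CongruenceSubgroup Matrix.SpecialLinearGroup Literature.NumberTheory.EllipticCurves.ModularForms

namespace Summit.BirchSwinnertonDyer.BirchSwinnertonDyer.Theorems.ManinLocalTwoThree

/-! ### Finite-dimensionality of the invariant functions -/

section FiniteDim

/-- **`cuspInvariants M K` is finite-dimensional** (`M ≥ 1`, `K` a field): a `Γ₀(M)`-invariant function is determined by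
its values on the finitely many classes of bottom rows `(c, d) mod M` (two cusps whose chosen matrices have congruent
bottom rows lie in one `Γ₀(M)`-orbit, `exists_gamma0_smul_eq_of_cuspRel` with `k = 0`), so the module embeds in the
functions on `(ℤ/M)²`. [cite: DiamondShurman2005, Prop. 3.8.3] -/
theorem finiteDimensional_cuspInvariants (M : ℕ) [NeZero M] (K : Type*) [Field K] :
    FiniteDimensional K (cuspInvariants M K) := by
  let κ : OnePoint ℚ → ZMod M × ZMod M := fun x ↦ ((((cuspMatrix x) 1 0 : ℤ) : ZMod M), (((cuspMatrix x) 1 1 : ℤ) : ZMod M))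
  have hle : cuspInvariants M K ≤ LinearMap.range (LinearMap.funLeft K K κ) := by
    intro w hw
    rw [mem_cuspInvariants] at hw
    classical
    refine ⟨fun p ↦ if h : ∃ x, κ x = p then w h.choose else 0, ?_⟩
    funext x
    rw [LinearMap.funLeft_apply]
    have hx : ∃ x', κ x' = κ x := ⟨x, rfl⟩
    rw [dif_pos hx]
    -- the chosen point has a congruent bottom row, hence lies in the orbit of `x`
    have hk : κ hx.choose = κ x := hx.choose_spec
    have hc : ((((cuspMatrix hx.choose) 1 0 : ℤ) : ZMod M)) = (((cuspMatrix x) 1 0 : ℤ) : ZMod M) :=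
      congrArg Prod.fst hk
    have hd : ((((cuspMatrix hx.choose) 1 1 : ℤ) : ZMod M)) = (((cuspMatrix x) 1 1 : ℤ) : ZMod M) :=
      congrArg Prod.snd hk
    rw [ZMod.intCast_eq_intCast_iff_dvd_sub] at hc hd
    obtain ⟨m₁, hm₁⟩ := hc
    obtain ⟨m₂, hm₂⟩ := hd
    have hrel : ∃ k : ℤ, (M : ℤ) ∣ (cuspMatrix hx.choose) 1 0 * ((cuspMatrix x) 1 1 + k * (cuspMatrix x) 1 0)
        - (cuspMatrix hx.choose) 1 1 * (cuspMatrix x) 1 0 := by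
      refine ⟨0, m₂ * (cuspMatrix hx.choose) 1 0 - m₁ * (cuspMatrix hx.choose) 1 1, ?_⟩
      linear_combination (cuspMatrix hx.choose) 1 0 * hm₂ - (cuspMatrix hx.choose) 1 1 * hm₁
    obtain ⟨γ, hγ⟩ := exists_gamma0_smul_eq_of_cuspRel M (cuspMatrix x) (cuspMatrix hx.choose) hrel
    rw [cuspMatrix_smul_infty, cuspMatrix_smul_infty] at hγ
    rw [← hγ, hw]
  haveI : FiniteDimensional K (LinearMap.range (LinearMap.funLeft K K κ)) := inferInstance
  exact Submodule.finiteDimensional_of_le hle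

end FiniteDim

/-! ### The operators on boundary symbols -/

section Operators

variable (M : ℕ) {K : Type*} [CommRing K]

/-- A boundary symbol is `D w` for an invariant `w` (unfolding the image). [folklore] -/
theorem exists_of_mem_boundary {Φ : OnePoint ℚ → OnePoint ℚ → K}
    (hΦ : Φ ∈ (cuspInvariants M K).map (boundaryOf K)) :
    ∃ w : OnePoint ℚ → K, (∀ γ : Gamma0 M, ∀ x : OnePoint ℚ,
      w ((mapGL ℚ (γ : SL(2, ℤ)) : GL (Fin 2) ℚ) • x) = w x) ∧ boundaryOf K w = Φ := by
  obtain ⟨w, hw, rfl⟩ := Submodule.mem_map.mp hΦ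
  exact ⟨w, (mem_cuspInvariants M K w).mp hw, rfl⟩

variable {r q : ℕ} [NeZero r] [NeZero q] (hr : r.Prime) (hq : q.Prime)

/-- **`T_r = A_r + r B_r` on boundary symbols of level `M`** (`r ∤ M`): `symbolHecke` of `D w` is
`D(w ∘ ρ_r) + r · D(w ∘ ρ_r⁻¹)`. [cite: Shimura1971, §8.3 (8.3.2)] -/
theorem symbolHecke_eq_shift_of_mem (hM : ¬ r ∣ M) {Φ : OnePoint ℚ → OnePoint ℚ → K}
    (hΦ : Φ ∈ (cuspInvariants M K).map (boundaryOf K)) :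
    symbolHecke M r K Φ = symbolShift K (heckeNbrInfty hr) Φ + (r : K) • symbolShift K (heckeNbrZero hr) Φ := by
  obtain ⟨w, hw, rfl⟩ := exists_of_mem_boundary M hΦ
  funext a b
  simp only [symbolHecke_apply, boundaryOf_apply, Pi.add_apply, Pi.smul_apply, symbolShift_apply, smul_eq_mul,
    Finset.sum_sub_distrib]
  rw [← cuspFunHecke_apply, ← cuspFunHecke_apply, cuspFunHecke_eq_heckeNbr hr M hM w hw,
    cuspFunHecke_eq_heckeNbr hr M hM w hw]
  ring

/-- `A_q` preserves the boundary symbols of level `M` (`q ∤ M`): `w ∘ ρ_q` is invariant. [cite: DiamondShurman2005, Prop. 3.8.3] -/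
theorem symbolShift_heckeNbrInfty_mem (hMq : ¬ q ∣ M) {Φ : OnePoint ℚ → OnePoint ℚ → K}
    (hΦ : Φ ∈ (cuspInvariants M K).map (boundaryOf K)) :
    symbolShift K (heckeNbrInfty hq) Φ ∈ (cuspInvariants M K).map (boundaryOf K) := by
  obtain ⟨w, hw, rfl⟩ := exists_of_mem_boundary M hΦ
  refine Submodule.mem_map.mpr ⟨w ∘ heckeNbrInfty hq, ?_, symbolShift_boundaryOf K _ w⟩
  rw [mem_cuspInvariants]
  intro γ x
  obtain ⟨γ', h⟩ := sameOrbit_heckeNbrInfty hq M hMq (x := x) ⟨γ, rfl⟩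
  show w (heckeNbrInfty hq _) = w (heckeNbrInfty hq x)
  rw [← h, hw]

/-- `B_q` preserves the boundary symbols of level `M` (`q ∤ M`): `w ∘ ρ_q⁻¹` is invariant. [cite: DiamondShurman2005, Prop. 3.8.3] -/
theorem symbolShift_heckeNbrZero_mem (hMq : ¬ q ∣ M) {Φ : OnePoint ℚ → OnePoint ℚ → K}
    (hΦ : Φ ∈ (cuspInvariants M K).map (boundaryOf K)) :
    symbolShift K (heckeNbrZero hq) Φ ∈ (cuspInvariants M K).map (boundaryOf K) := by
  obtain ⟨w, hw, rfl⟩ := exists_of_mem_boundary M hΦ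
  refine Submodule.mem_map.mpr ⟨w ∘ heckeNbrZero hq, ?_, symbolShift_boundaryOf K _ w⟩
  rw [mem_cuspInvariants]
  intro γ x
  obtain ⟨γ', h⟩ := sameOrbit_heckeNbrZero hq M hMq (x := x) ⟨γ, rfl⟩
  show w (heckeNbrZero hq _) = w (heckeNbrZero hq x)
  rw [← h, hw]

include hr in
/-- `T_r` preserves the boundary symbols of level `M` (`r` prime, `r ∤ M`). [cite: Shimura1971, §8.3 (8.3.2)] -/
theorem symbolHecke_mem (hM : ¬ r ∣ M) {Φ : OnePoint ℚ → OnePoint ℚ → K}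
    (hΦ : Φ ∈ (cuspInvariants M K).map (boundaryOf K)) :
    symbolHecke M r K Φ ∈ (cuspInvariants M K).map (boundaryOf K) := by
  rw [symbolHecke_eq_shift_of_mem M hr hM hΦ]
  exact Submodule.add_mem _ (symbolShift_heckeNbrInfty_mem M hr hM hΦ)
    (Submodule.smul_mem _ _ (symbolShift_heckeNbrZero_mem M hr hM hΦ))

/-- **`B_r A_r = 1` on boundary symbols** (`r ∤ M`). [cite: DiamondShurman2005, Prop. 3.8.3] -/
theorem symbolShift_zero_infty (hM : ¬ r ∣ M) {Φ : OnePoint ℚ → OnePoint ℚ → K}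
    (hΦ : Φ ∈ (cuspInvariants M K).map (boundaryOf K)) :
    symbolShift K (heckeNbrZero hr) (symbolShift K (heckeNbrInfty hr) Φ) = Φ := by
  obtain ⟨w, hw, rfl⟩ := exists_of_mem_boundary M hΦ
  funext a b
  simp only [symbolShift_apply, boundaryOf_apply]
  obtain ⟨γa, ha⟩ := sameOrbit_heckeNbrInfty_heckeNbrZero hr M hM a
  obtain ⟨γb, hb⟩ := sameOrbit_heckeNbrInfty_heckeNbrZero hr M hM b
  conv_rhs => rw [← ha, ← hb, hw, hw]

/-- **`A_r B_r = 1` on boundary symbols** (`r ∤ M`). [cite: DiamondShurman2005, Prop. 3.8.3] -/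
theorem symbolShift_infty_zero (hM : ¬ r ∣ M) {Φ : OnePoint ℚ → OnePoint ℚ → K}
    (hΦ : Φ ∈ (cuspInvariants M K).map (boundaryOf K)) :
    symbolShift K (heckeNbrInfty hr) (symbolShift K (heckeNbrZero hr) Φ) = Φ := by
  obtain ⟨w, hw, rfl⟩ := exists_of_mem_boundary M hΦ
  funext a b
  simp only [symbolShift_apply, boundaryOf_apply]
  obtain ⟨γa, ha⟩ := sameOrbit_heckeNbrZero_heckeNbrInfty hr M hM a
  obtain ⟨γb, hb⟩ := sameOrbit_heckeNbrZero_heckeNbrInfty hr M hM b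
  conv_rhs => rw [← ha, ← hb, hw, hw]

/-- **`A_q A_r = A_r A_q` on boundary symbols** (`q, r ∤ M`). [cite: DiamondShurman2005, Prop. 3.8.3] -/
theorem symbolShift_infty_comm (hM : ¬ r ∣ M) (hMq : ¬ q ∣ M) {Φ : OnePoint ℚ → OnePoint ℚ → K}
    (hΦ : Φ ∈ (cuspInvariants M K).map (boundaryOf K)) :
    symbolShift K (heckeNbrInfty hq) (symbolShift K (heckeNbrInfty hr) Φ) =
      symbolShift K (heckeNbrInfty hr) (symbolShift K (heckeNbrInfty hq) Φ) := by
  obtain ⟨w, hw, rfl⟩ := exists_of_mem_boundary M hΦ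
  funext a b
  simp only [symbolShift_apply, boundaryOf_apply]
  -- `ρ_r (ρ_q y) ∈ Γ₀(M) ρ_q (ρ_r y)`
  obtain ⟨γa, ha⟩ := sameOrbit_heckeNbrInfty_comm M hr hq hM hMq a
  obtain ⟨γb, hb⟩ := sameOrbit_heckeNbrInfty_comm M hr hq hM hMq b
  rw [← ha, ← hb, hw, hw]

/-- **`A_q B_r = B_r A_q` on boundary symbols** (`q, r ∤ M`), from `B_r = A_r⁻¹` and `A_q A_r = A_r A_q`. [cite: DiamondShurman2005, Prop. 3.8.3] -/
theorem symbolShift_infty_zero_comm (hM : ¬ r ∣ M) (hMq : ¬ q ∣ M) {Φ : OnePoint ℚ → OnePoint ℚ → K}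
    (hΦ : Φ ∈ (cuspInvariants M K).map (boundaryOf K)) :
    symbolShift K (heckeNbrInfty hq) (symbolShift K (heckeNbrZero hr) Φ) =
      symbolShift K (heckeNbrZero hr) (symbolShift K (heckeNbrInfty hq) Φ) := by
  have h1 : symbolShift K (heckeNbrZero hr) Φ ∈ (cuspInvariants M K).map (boundaryOf K) :=
    symbolShift_heckeNbrZero_mem M hr hM hΦ
  have h2 : symbolShift K (heckeNbrInfty hq) (symbolShift K (heckeNbrZero hr) Φ) ∈
      (cuspInvariants M K).map (boundaryOf K) := symbolShift_heckeNbrInfty_mem M hq hMq h1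
  calc symbolShift K (heckeNbrInfty hq) (symbolShift K (heckeNbrZero hr) Φ)
      = symbolShift K (heckeNbrZero hr) (symbolShift K (heckeNbrInfty hr)
          (symbolShift K (heckeNbrInfty hq) (symbolShift K (heckeNbrZero hr) Φ))) :=
        (symbolShift_zero_infty M hr hM h2).symm
    _ = symbolShift K (heckeNbrZero hr) (symbolShift K (heckeNbrInfty hq)
          (symbolShift K (heckeNbrInfty hr) (symbolShift K (heckeNbrZero hr) Φ))) := by
        rw [symbolShift_infty_comm M hq hr hMq hM h1]
    _ = symbolShift K (heckeNbrZero hr) (symbolShift K (heckeNbrInfty hq) Φ) := by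
        rw [symbolShift_infty_zero M hr hM hΦ]

include hr in
/-- **`A_q T_r = T_r A_q` on boundary symbols** (`q, r` primes `∤ M`). [cite: Shimura1971, §8.3 (8.3.2)] -/
theorem symbolHecke_symbolShift_comm (hM : ¬ r ∣ M) (hMq : ¬ q ∣ M) {Φ : OnePoint ℚ → OnePoint ℚ → K}
    (hΦ : Φ ∈ (cuspInvariants M K).map (boundaryOf K)) :
    symbolHecke M r K (symbolShift K (heckeNbrInfty hq) Φ) = symbolShift K (heckeNbrInfty hq) (symbolHecke M r K Φ) := by
  rw [symbolHecke_eq_shift_of_mem M hr hM (symbolShift_heckeNbrInfty_mem M hq hMq hΦ),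
    symbolHecke_eq_shift_of_mem M hr hM hΦ, map_add, map_smul, symbolShift_infty_comm M hq hr hMq hM hΦ,
    symbolShift_infty_zero_comm M hr hq hM hMq hΦ]

include hr in
/-- **`A_q` preserves `B_M ∩` (generalised `μ`-eigenspace of `T_r`)** (`q, r` primes `∤ M`): `(T_r − μ)^k` commutes with
`A_q` on `B_M`. [cite: Shimura1971, §8.3 (8.3.2)] -/
theorem symbolShift_mem_maxGenEigenspace (hM : ¬ r ∣ M) (hMq : ¬ q ∣ M) {Φ : OnePoint ℚ → OnePoint ℚ → K}
    (hΦ : Φ ∈ (cuspInvariants M K).map (boundaryOf K)) {μ : K}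
    (hgen : Φ ∈ Module.End.maxGenEigenspace (symbolHecke M r K) μ) :
    symbolShift K (heckeNbrInfty hq) Φ ∈ Module.End.maxGenEigenspace (symbolHecke M r K) μ := by
  rw [Module.End.mem_maxGenEigenspace] at hgen ⊢
  obtain ⟨k, hk⟩ := hgen
  refine ⟨k, ?_⟩
  -- `(T − μ)^k A Ψ = A (T − μ)^k Ψ` for `Ψ ∈ B_M`, by induction on `k`
  have key : ∀ n : ℕ, ∀ Ψ ∈ (cuspInvariants M K).map (boundaryOf K),
      ((symbolHecke M r K - μ • 1) ^ n) Ψ ∈ (cuspInvariants M K).map (boundaryOf K) ∧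
      ((symbolHecke M r K - μ • 1) ^ n) (symbolShift K (heckeNbrInfty hq) Ψ) =
        symbolShift K (heckeNbrInfty hq) (((symbolHecke M r K - μ • 1) ^ n) Ψ) := by
    intro n
    induction n with
    | zero =>
      intro Ψ hΨ
      refine ⟨?_, ?_⟩
      · simpa only [pow_zero, Module.End.one_apply] using hΨ
      · simp only [pow_zero, Module.End.one_apply]
    | succ n ih =>
      intro Ψ hΨ
      have hΨ1 : (symbolHecke M r K - μ • 1) Ψ ∈ (cuspInvariants M K).map (boundaryOf K) := by
        rw [LinearMap.sub_apply, LinearMap.smul_apply, Module.End.one_apply]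
        exact Submodule.sub_mem _ (symbolHecke_mem M hr hM hΨ) (Submodule.smul_mem _ _ hΨ)
      obtain ⟨ihmem, iheq⟩ := ih _ hΨ1
      refine ⟨?_, ?_⟩
      · rw [pow_succ, Module.End.mul_apply]
        exact ihmem
      · rw [pow_succ, Module.End.mul_apply, Module.End.mul_apply, ← iheq]
        congr 1
        rw [LinearMap.sub_apply, LinearMap.sub_apply, LinearMap.smul_apply, LinearMap.smul_apply,
          Module.End.one_apply, Module.End.one_apply, map_sub, map_smul,
          symbolHecke_symbolShift_comm M hr hq hM hMq hΨ]
  rw [(key k Φ hΦ).2, hk, map_zero]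

/-! ### Dependence on `r mod M` and multiplicativity -/

/-- **`A_{r₂} A_{r₁} = A_u` on boundary symbols when `r₁ r₂ ≡ u (mod M)`** (primes `∤ M`). [cite: DiamondShurman2005, Prop. 3.8.3] -/
theorem symbolShift_infty_mul_of_dvd {r₁ r₂ u : ℕ} [NeZero r₁] [NeZero r₂] [NeZero u]
    (h₁ : r₁.Prime) (h₂ : r₂.Prime) (hu : u.Prime) (hM₁ : ¬ r₁ ∣ M) (hM₂ : ¬ r₂ ∣ M) (hMu : ¬ u ∣ M)
    (hcong : (M : ℤ) ∣ (r₁ : ℤ) * r₂ - u) {Φ : OnePoint ℚ → OnePoint ℚ → K}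
    (hΦ : Φ ∈ (cuspInvariants M K).map (boundaryOf K)) :
    symbolShift K (heckeNbrInfty h₂) (symbolShift K (heckeNbrInfty h₁) Φ) = symbolShift K (heckeNbrInfty hu) Φ := by
  obtain ⟨w, hw, rfl⟩ := exists_of_mem_boundary M hΦ
  funext a b
  simp only [symbolShift_apply, boundaryOf_apply]
  obtain ⟨γa, ha⟩ := sameOrbit_heckeNbrInfty_heckeNbrInfty_of_dvd M h₁ h₂ hu hM₁ hM₂ hMu hcong a
  obtain ⟨γb, hb⟩ := sameOrbit_heckeNbrInfty_heckeNbrInfty_of_dvd M h₁ h₂ hu hM₁ hM₂ hMu hcong b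
  rw [← ha, ← hb, hw, hw]

/-- **`A_u = 1` on boundary symbols when `u ≡ 1 (mod M)`** (`u` prime `∤ M`). [cite: DiamondShurman2005, Prop. 3.8.3] -/
theorem symbolShift_infty_of_dvd_sub_one {u : ℕ} [NeZero u] (hu : u.Prime) (hMu : ¬ u ∣ M)
    (hcong : (M : ℤ) ∣ (u : ℤ) - 1) {Φ : OnePoint ℚ → OnePoint ℚ → K}
    (hΦ : Φ ∈ (cuspInvariants M K).map (boundaryOf K)) :
    symbolShift K (heckeNbrInfty hu) Φ = Φ := by
  obtain ⟨w, hw, rfl⟩ := exists_of_mem_boundary M hΦ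
  funext a b
  simp only [symbolShift_apply, boundaryOf_apply]
  obtain ⟨γa, ha⟩ := sameOrbit_heckeNbrInfty_self_of_dvd M hu hMu hcong a
  obtain ⟨γb, hb⟩ := sameOrbit_heckeNbrInfty_self_of_dvd M hu hMu hcong b
  conv_rhs => rw [← ha, ← hb, hw, hw]

/-- **`A_r = A_{r'}` on boundary symbols when `r ≡ r' (mod M)`** (primes `∤ M`). [cite: DiamondShurman2005, Prop. 3.8.3] -/
theorem symbolShift_infty_congr {r' : ℕ} [NeZero r'] (hr' : r'.Prime) (hM : ¬ r ∣ M) (hM' : ¬ r' ∣ M)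
    (hcong : (M : ℤ) ∣ (r : ℤ) - r') {Φ : OnePoint ℚ → OnePoint ℚ → K}
    (hΦ : Φ ∈ (cuspInvariants M K).map (boundaryOf K)) :
    symbolShift K (heckeNbrInfty hr) Φ = symbolShift K (heckeNbrInfty hr') Φ := by
  obtain ⟨w, hw, rfl⟩ := exists_of_mem_boundary M hΦ
  funext a b
  simp only [symbolShift_apply, boundaryOf_apply]
  obtain ⟨γa, ha⟩ := sameOrbit_heckeNbrInfty_of_dvd M hr hr' hM hM' hcong a
  obtain ⟨γb, hb⟩ := sameOrbit_heckeNbrInfty_of_dvd M hr hr' hM hM' hcong b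
  rw [← ha, ← hb, hw, hw]

end Operators

end Summit.BirchSwinnertonDyer.BirchSwinnertonDyer.Theorems.ManinLocalTwoThree
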